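import Literature.Analysis.FluidPDE.CKNMorreyDualIdentity
import Literature.Analysis.FluidPDE.CKNMorreyBootstrap
import HarnessLib

/-!
# The dual Morrey estimate of Lemarié-Rieusset 2016, Lemma 13.5: the velocity against test functions

Analysis/FluidPDE support file (everything proved) for the discharge of the named fact
`Literature.Analysis.FluidPDE.LemarieRieusset2016.lemma13_5_step` (`CKNMorreyBootstrap.lean`;
Lemarié-Rieusset 2016, proof of Lemma 13.5, pp. 475–477). In print the localised velocity
`v = φu` is represented through the heat kernel and bounded pointwise,
"`|v| ≤ C 1_{Q₂}(𝓘₂(|g|) + ∑ 𝓘₁(|hᵢ|) + 𝓘₂(|γ|) + 𝓘₂(|η|) + ∑ 𝓘₁(φ|uⱼuₗ|))`" ((13.52),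
p. 475), `𝓘_α` the parabolic Riesz potentials of Thm. 5.3. This file proves the **dual form** of
such a bound, which is what the Morrey estimate of Lemma 13.5 consumes: for a distributional
solution `(u, p)` of the Navier–Stokes equations with viscosity `ν > 0` and a divergence-free
locally integrable force `f` on a region `Ω ⊇ Q₂ = Q_{r₂}(z₀)`, for `0 < r₃ < r₂` and a vector
`c` of norm at most one, there are constants `C₀, C` such that for every scalar test function
`θ` supported in `Q₃ = Q_{r₃}(z₀)`

  `|∫ θ ⟪u, c⟫| ≤ C₀ ∫ |θ| + C ∫ (𝓘₂(1_{Q₂}|f|) + 𝓘₁(1_{Q₂}|u|²)) |θ|`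

(`LemarieRieusset2016.dual_pairing_bound`). It is obtained from the caloric master identity
(`CKNMorreyDualIdentity.lean`: momentum tested with `(φη)c`, `η = 𝒰_ν[θ]`, pressure equation
tested with `φΞ`, `Ξ = 𝒰_ν[∂_c N θ]`) with the product cut-off `φ = χ(t)ω(x)` equal to `1` on
`Q_{ρ₁}(z₀)` and supported in `Q_{ρ₂}(z₀)`, `r₃ < ρ₁ < ρ₂ < r₂`, and the pointwise bounds of
`CaloricDualTestFields.lean`: the terms without a derivative of the cut-off and with a singular
caloric kernel (`φ uᵢu_c ∂ᵢη`, `φ uᵢuⱼ ∂ⱼ∂ᵢΞ`, resp. `φ f_c η`) are dominated by `𝓘₁(1_{Q₂}|u|²)`,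
resp. `𝓘₂(1_{Q₂}|f|)` (kernels `|∇W| ≤ Cδ₂⁻⁴`, `|∂ᵤ∂ᵥ∂_c e^{aΔ}Γ₀| ≤ Cδ₂⁻⁴`, `|W| ≤ Cδ₂⁻³`, and
Tonelli), the term `φ p 𝒰_ν[Λ∂_cθ]` has a bounded kernel, and every term carrying a derivative of
`φ` lives where `φ` is not flat, a region parabolically separated from the support of `θ`, on
which all caloric fields are bounded by `C ∫|θ|`. (The printed proof bounds the analogous
"cut-off" terms `𝓘₂(|(∂ₜφ)u|)`, `𝓘₁(|hᵢ|)`, `𝓘₂(|γ|)` by lower-order Morrey data; in dual form they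
are of order `∫|θ|`.) The Morrey-space hypotheses of Lemma 13.5 are not used here; they enter only
the bookkeeping that turns this bound into `1_{Q₃}u ∈ ℳ₂^{3,σ}`.

## References

* P. G. Lemarié-Rieusset, *The Navier–Stokes Problem in the 21st Century*, CRC Press (2016),
  §13.9 Step 3 (13.50)–(13.52) pp. 474–475, proof of Lemma 13.5 pp. 475–477. [LemarieRieusset2016]
-/

noncomputable section

open MeasureTheory Set Function Filter TopologicalSpace Metric
open scoped Topology RealInnerProductSpace Laplacian ENNReal NNReal

namespace Literature.Analysis.FluidPDE

/-! ### Pointwise bounds for products `T · m · X` -/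

section Generic

/-- A product `T · m · X` of reals is bounded in `ℝ≥0∞` by the product of bounds of its factors,
or vanishes with `T`. [folklore] -/
theorem enorm_mul_mul_le_of_bounds {T m Xf : ℝ} {A D P : ℝ≥0∞}
    (h : T = 0 ∨ (‖T‖ₑ ≤ A ∧ ‖m‖ₑ ≤ D ∧ ‖Xf‖ₑ ≤ P)) :
    ‖T * m * Xf‖ₑ ≤ A * D * P := by
  rcases h with h0 | ⟨hT, hm, hX⟩
  · rw [h0, zero_mul, zero_mul, enorm_zero]; exact zero_le
  · rw [enorm_mul, enorm_mul]
    exact mul_le_mul' (mul_le_mul' hT hm) hX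

/-- `‖r‖ₑ ≤ ofReal M` from `|r| ≤ M`. [folklore] -/
theorem enorm_le_ofReal_of_abs_le {r M : ℝ} (h : |r| ≤ M) : ‖r‖ₑ ≤ ENNReal.ofReal M := by
  rw [Real.enorm_eq_ofReal_abs]; exact ENNReal.ofReal_le_ofReal h

/-- `‖⟪u, a⟫‖ₑ ≤ ‖u‖ₑ` for `‖a‖ ≤ 1`. [folklore] -/
theorem enorm_inner_le_enorm_of_norm_le_one {E : Type*} [NormedAddCommGroup E]
    [InnerProductSpace ℝ E] (u : E) {a : E} (ha : ‖a‖ ≤ 1) : ‖(⟪u, a⟫ : ℝ)‖ₑ ≤ ‖u‖ₑ := by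
  rw [← ofReal_norm, ← ofReal_norm]
  refine ENNReal.ofReal_le_ofReal ?_
  calc ‖(⟪u, a⟫ : ℝ)‖ ≤ ‖u‖ * ‖a‖ := norm_inner_le_norm u a
    _ ≤ ‖u‖ * 1 := by gcongr
    _ = ‖u‖ := mul_one _

/-- `‖⟪u, a⟫ ⟪u, a'⟫‖ₑ ≤ ‖u‖ₑ²` for `‖a‖, ‖a'‖ ≤ 1`. [folklore] -/
theorem enorm_inner_mul_inner_le {E : Type*} [NormedAddCommGroup E] [InnerProductSpace ℝ E]
    (u : E) {a a' : E} (ha : ‖a‖ ≤ 1) (ha' : ‖a'‖ ≤ 1) :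
    ‖(⟪u, a⟫ : ℝ) * ⟪u, a'⟫‖ₑ ≤ ‖u‖ₑ * ‖u‖ₑ := by
  rw [enorm_mul]
  exact mul_le_mul' (enorm_inner_le_enorm_of_norm_le_one u ha)
    (enorm_inner_le_enorm_of_norm_le_one u ha')

/-- `‖a + b + c + d + e + g‖ₑ ≤ ‖a‖ₑ + ‖b‖ₑ + ‖c‖ₑ + ‖d‖ₑ + ‖e‖ₑ + ‖g‖ₑ` for reals. [folklore] -/
theorem enorm_add_six_le (a b c d e g : ℝ) :
    ‖a + b + c + d + e + g‖ₑ ≤ ‖a‖ₑ + ‖b‖ₑ + ‖c‖ₑ + ‖d‖ₑ + ‖e‖ₑ + ‖g‖ₑ :=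
  calc ‖a + b + c + d + e + g‖ₑ ≤ ‖a + b + c + d + e‖ₑ + ‖g‖ₑ := enorm_add_le _ _
    _ ≤ ‖a + b + c + d‖ₑ + ‖e‖ₑ + ‖g‖ₑ := by gcongr; exact enorm_add_le _ _
    _ ≤ ‖a + b + c‖ₑ + ‖d‖ₑ + ‖e‖ₑ + ‖g‖ₑ := by gcongr; exact enorm_add_le _ _
    _ ≤ ‖a + b‖ₑ + ‖c‖ₑ + ‖d‖ₑ + ‖e‖ₑ + ‖g‖ₑ := by gcongr; exact enorm_add_le _ _
    _ ≤ ‖a‖ₑ + ‖b‖ₑ + ‖c‖ₑ + ‖d‖ₑ + ‖e‖ₑ + ‖g‖ₑ := by gcongr; exact enorm_add_le _ _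

/-- `‖φ‖ₑ ≤ 1` for `0 ≤ φ ≤ 1`. [folklore] -/
theorem enorm_le_one_of_mem_unit {r : ℝ} (h0 : 0 ≤ r) (h1 : r ≤ 1) : ‖r‖ₑ ≤ 1 := by
  rw [Real.enorm_eq_ofReal h0]; exact ENNReal.ofReal_le_one.2 h1

end Generic

/-! ### The product cut-off `φ = χ(t) ω(x)` -/

section Cutoff

/-- **A product cut-off adapted to two centred parabolic cylinders.** For `0 < ρ₁ < ρ₂` and a
centre `z₀ = (t₀, x₀)` there is a space–time test function `φ` on `ℝ × ℝ³` with `0 ≤ φ ≤ 1`,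
supported in the closed box `[t₀-ρ₂², t₀+ρ₂²] × B̄(x₀, ρ₂)`, and **flat** on the open box
`{|t - t₀| < ρ₁²} × B(x₀, ρ₁)`: there `φ = 1` and `∂ₜφ`, `∇φ`, `Δφ`, `D²φ` vanish
(`φ(t, x) = χ(t) ω(x)` with smooth bumps `χ`, `ω`; Lemarié-Rieusset 2016, p. 474: "a function
`φ ∈ 𝒟(ℝ × ℝ³)` which is equal to `1` on `Q₃` and is compactly supported in `Q₂`"). [folklore] -/
theorem exists_product_cutoff (z₀ : ℝ × EuclideanSpace ℝ (Fin 3)) {ρ₁ ρ₂ : ℝ} (hρ₁ : 0 < ρ₁)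
    (hρ₁₂ : ρ₁ < ρ₂) :
    ∃ φ : ℝ → EuclideanSpace ℝ (Fin 3) → ℝ,
      IsSpaceTimeTestOn (⊤ : Opens (ℝ × EuclideanSpace ℝ (Fin 3))) φ ∧
      (∀ t x, 0 ≤ φ t x ∧ φ t x ≤ 1) ∧
      tsupport (uncurry φ) ⊆ closedBall z₀.1 (ρ₂ ^ 2) ×ˢ closedBall z₀.2 ρ₂ ∧
      ∀ z : ℝ × EuclideanSpace ℝ (Fin 3), |z.1 - z₀.1| < ρ₁ ^ 2 → dist z.2 z₀.2 < ρ₁ →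
        φ z.1 z.2 = 1 ∧ timeDeriv φ z.1 z.2 = 0 ∧ fderiv ℝ (φ z.1) z.2 = 0 ∧
          (Δ (φ z.1)) z.2 = 0 ∧
          ∀ v w : EuclideanSpace ℝ (Fin 3), fderiv ℝ (fun y => fderiv ℝ (φ z.1) y v) z.2 w = 0 := by
  have hρ₂ : 0 < ρ₂ := hρ₁.trans hρ₁₂
  have hsq : ρ₁ ^ 2 < ρ₂ ^ 2 := by nlinarith
  -- the two bumps
  let χ : ContDiffBump z₀.1 := ⟨ρ₁ ^ 2, ρ₂ ^ 2, by positivity, hsq⟩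
  let ω : ContDiffBump z₀.2 := ⟨ρ₁, ρ₂, hρ₁, hρ₁₂⟩
  refine ⟨fun t x => χ t * ω x, ?_, ?_, ?_, ?_⟩
  · -- test function on `⊤`
    have hsupp : tsupport (uncurry fun t x => χ t * ω x) ⊆
        closedBall z₀.1 (ρ₂ ^ 2) ×ˢ closedBall z₀.2 ρ₂ := by
      refine closure_minimal (fun z hz => ?_) (isClosed_closedBall.prod isClosed_closedBall)
      have hz' : χ z.1 ≠ 0 ∧ ω z.2 ≠ 0 := mul_ne_zero_iff.1 hz
      have h1 : z.1 ∈ Function.support χ := hz'.1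
      have h2 : z.2 ∈ Function.support ω := hz'.2
      rw [χ.support_eq] at h1
      rw [ω.support_eq] at h2
      exact ⟨ball_subset_closedBall h1, ball_subset_closedBall h2⟩
    refine ⟨?_, ?_, fun _ _ => trivial⟩
    · exact (χ.contDiff.comp contDiff_fst).mul (ω.contDiff.comp contDiff_snd)
    · exact HasCompactSupport.intro' ((isCompact_closedBall _ _).prod (isCompact_closedBall _ _))
        (isClosed_closedBall.prod isClosed_closedBall)
        (fun z hz => image_eq_zero_of_notMem_tsupport (fun h => hz (hsupp h)))
  · intro t x
    exact ⟨mul_nonneg χ.nonneg ω.nonneg, mul_le_one₀ χ.le_one ω.nonneg ω.le_one⟩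
  · refine closure_minimal (fun z hz => ?_) (isClosed_closedBall.prod isClosed_closedBall)
    have hz' : χ z.1 ≠ 0 ∧ ω z.2 ≠ 0 := mul_ne_zero_iff.1 hz
    have h1 : z.1 ∈ Function.support χ := hz'.1
    have h2 : z.2 ∈ Function.support ω := hz'.2
    rw [χ.support_eq] at h1
    rw [ω.support_eq] at h2
    exact ⟨ball_subset_closedBall h1, ball_subset_closedBall h2⟩
  · rintro ⟨s, y⟩ hs hy
    simp only at hs hy ⊢
    have hs' : s ∈ ball z₀.1 χ.rIn := by
      rw [mem_ball, Real.dist_eq]; exact hs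
    have hy' : y ∈ ball z₀.2 ω.rIn := hy
    -- `ω = 1` near `y`, `χ = 1` near `s`
    have hω1 : (ω : EuclideanSpace ℝ (Fin 3) → ℝ) =ᶠ[𝓝 y] 1 := ω.eventuallyEq_one_of_mem_ball hy'
    have hχ1 : (χ : ℝ → ℝ) =ᶠ[𝓝 s] 1 := χ.eventuallyEq_one_of_mem_ball hs'
    have hωy : ω y = 1 := ω.one_of_mem_closedBall (ball_subset_closedBall hy')
    have hχs : χ s = 1 := χ.one_of_mem_closedBall (ball_subset_closedBall hs')
    -- the slice `x ↦ χ s * ω x` is eventually the constant `χ s`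
    have hslice : (fun x => χ s * ω x) =ᶠ[𝓝 y] fun _ => χ s := by
      filter_upwards [hω1] with x hx
      rw [hx, Pi.one_apply, mul_one]
    -- first derivatives vanish on the whole ball around `y`
    have hfd : ∀ x ∈ ball z₀.2 ω.rIn, fderiv ℝ (fun x' => χ s * ω x') x = 0 := by
      intro x hx
      have hsl : (fun x' => χ s * ω x') =ᶠ[𝓝 x] fun _ => χ s := by
        filter_upwards [ω.eventuallyEq_one_of_mem_ball hx] with x' hx'
        rw [hx', Pi.one_apply, mul_one]
      rw [hsl.fderiv_eq]; simp
    have hfd0 : fderiv ℝ (fun x' => χ s * ω x') y = 0 := hfd y hy'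
    -- second derivatives vanish at `y`
    have hfd2 : ∀ v w : EuclideanSpace ℝ (Fin 3),
        fderiv ℝ (fun x => fderiv ℝ (fun x' => χ s * ω x') x v) y w = 0 := by
      intro v w
      have hev : (fun x => fderiv ℝ (fun x' => χ s * ω x') x v) =ᶠ[𝓝 y] fun _ => (0 : ℝ) := by
        filter_upwards [isOpen_ball.mem_nhds hy'] with x hx
        rw [hfd x hx]; rfl
      rw [hev.fderiv_eq]; simp
    refine ⟨by rw [hχs, hωy, mul_one], ?_, hfd0, ?_, hfd2⟩
    · -- time derivative
      rw [timeDeriv_apply]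
      have htime : (fun s' => χ s' * ω y) =ᶠ[𝓝 s] fun _ => ω y := by
        filter_upwards [hχ1] with s' hs'
        rw [hs', Pi.one_apply, one_mul]
      rw [htime.deriv_eq, deriv_const]
    · -- Laplacian: sum of second derivatives along the standard frame
      have h2 : ContDiff ℝ 2 (fun x' => χ s * ω x') :=
        (contDiff_const.mul ω.contDiff)
      rw [laplacian_eq_sum_fderiv_fderiv_normed (EuclideanSpace.basisFun (Fin 3) ℝ) h2 y]
      exact Finset.sum_eq_zero fun i _ => hfd2 _ _

end Cutoff

/-! ### Geometry of the three cylinders -/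

section Geometry

/-- **Parabolic separation of the transition region from the inner cylinder.** If `(s, y)` is
outside the open box `{|s - t₀| < ρ₁²} × B(x₀, ρ₁)` and `(t, x) ∈ Q_{r₃}(t₀, x₀)` with `s < t`
(`r₃ < ρ₁`), then `ν(t - s) ≥ ν(ρ₁² - r₃²)` or `‖y - x‖ ≥ ρ₁ - r₃`. [folklore] -/
theorem parabolic_separation {ν r₃ ρ₁ : ℝ} (hν : 0 < ν) (hr₃ : 0 < r₃) (h : r₃ < ρ₁)
    {z₀ z w : ℝ × EuclideanSpace ℝ (Fin 3)}
    (hz : ρ₁ ^ 2 ≤ |z.1 - z₀.1| ∨ ρ₁ ≤ dist z.2 z₀.2)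
    (hw : w ∈ parabolicCylinderCentered r₃ z₀) (hst : z.1 < w.1) :
    ν * (ρ₁ ^ 2 - r₃ ^ 2) ≤ ν * (w.1 - z.1) ∨ ρ₁ - r₃ ≤ ‖z.2 - w.2‖ := by
  rw [mem_parabolicCylinderCentered] at hw
  rcases hz with ht | hx
  · left
    refine mul_le_mul_of_nonneg_left ?_ hν.le
    have hr : r₃ ^ 2 < ρ₁ ^ 2 := by nlinarith
    rcases le_abs'.1 ht with h1 | h1
    · linarith [hw.1.1]
    · linarith [hw.1.2]
  · right
    have h1 : dist z.2 z₀.2 ≤ dist z.2 w.2 + dist w.2 z₀.2 := dist_triangle _ _ _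
    rw [← dist_eq_norm]
    linarith [hw.2]

/-- **The data seen from the support of the cut-off lie at bounded parabolic distance.** If
`(s, y)` is in the closed box `[t₀-ρ₂², t₀+ρ₂²] × B̄(x₀, ρ₂)` and `(t, x) ∈ Q_{r₃}(t₀, x₀)`, then
`ν(t - s) ≤ ν(ρ₂² + r₃²)` and `‖y - x‖ ≤ ρ₂ + r₃`. [folklore] -/
theorem parabolic_range {ν r₃ ρ₂ : ℝ} (hν : 0 < ν) {z₀ z w : ℝ × EuclideanSpace ℝ (Fin 3)}
    (hz : z ∈ closedBall z₀.1 (ρ₂ ^ 2) ×ˢ closedBall z₀.2 ρ₂)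
    (hw : w ∈ parabolicCylinderCentered r₃ z₀) :
    ν * (w.1 - z.1) ≤ ν * (ρ₂ ^ 2 + r₃ ^ 2) ∧ ‖z.2 - w.2‖ ≤ ρ₂ + r₃ := by
  rw [mem_parabolicCylinderCentered] at hw
  obtain ⟨h1, h2⟩ := hz
  rw [mem_closedBall, Real.dist_eq, abs_le] at h1
  rw [mem_closedBall] at h2
  refine ⟨mul_le_mul_of_nonneg_left (by linarith [hw.1.2]) hν.le, ?_⟩
  have h3 : dist z.2 w.2 ≤ dist z.2 z₀.2 + dist z₀.2 w.2 := dist_triangle _ _ _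
  rw [dist_comm z₀.2 w.2] at h3
  rw [← dist_eq_norm]
  linarith [hw.2]

/-- The closed box `[t₀-ρ₂², t₀+ρ₂²] × B̄(x₀, ρ₂)` lies in the open cylinder `Q_{r₂}(t₀, x₀)` for
`0 ≤ ρ₂ < r₂`. [folklore] -/
theorem closedBox_subset_parabolicCylinderCentered {ρ₂ r₂ : ℝ} (hρ₂ : 0 ≤ ρ₂) (h : ρ₂ < r₂)
    (z₀ : ℝ × EuclideanSpace ℝ (Fin 3)) :
    closedBall z₀.1 (ρ₂ ^ 2) ×ˢ closedBall z₀.2 ρ₂ ⊆ parabolicCylinderCentered r₂ z₀ := by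
  intro z hz
  obtain ⟨h1, h2⟩ := hz
  rw [mem_closedBall, Real.dist_eq, abs_le] at h1
  rw [mem_closedBall] at h2
  have hsq : ρ₂ ^ 2 < r₂ ^ 2 := by nlinarith
  rw [mem_parabolicCylinderCentered]
  exact ⟨⟨by linarith, by linarith⟩, lt_of_le_of_lt h2 h⟩

end Geometry

/-! ### The dual pairing bound -/

section Estimate

variable {Ω : Opens (ℝ × EuclideanSpace ℝ (Fin 3))} {ν : ℝ}
  {f u : ℝ → EuclideanSpace ℝ (Fin 3) → EuclideanSpace ℝ (Fin 3)}
  {p : ℝ → EuclideanSpace ℝ (Fin 3) → ℝ}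
  {z₀ : ℝ × EuclideanSpace ℝ (Fin 3)} {r₂ r₃ : ℝ}

/-- The product measure on `(ℝ × ℝ³) × (ℝ × ℝ³)` is the volume. [folklore] -/
private theorem volume_prod_eq :
    ((volume : Measure (ℝ × EuclideanSpace ℝ (Fin 3))).prod
      (volume : Measure (ℝ × EuclideanSpace ℝ (Fin 3)))) = volume :=
  (Measure.volume_eq_prod _ _).symm

/-- **Tonelli for a main term**: `∫⁻ U(z) (∫⁻ k(z,w) Θ(w) dw) dz = ∫⁻ (∫⁻ U(z) k(z,w) dz) Θ(w) dw`
for `U` a.e.-measurable and pointwise finite, `k` measurable, `Θ` measurable and pointwise finite.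
[folklore] -/
theorem lintegral_mul_lintegral_swap {U Θ : ℝ × EuclideanSpace ℝ (Fin 3) → ℝ≥0∞}
    {k : (ℝ × EuclideanSpace ℝ (Fin 3)) × (ℝ × EuclideanSpace ℝ (Fin 3)) → ℝ≥0∞}
    (hU : AEMeasurable U volume) (hUfin : ∀ z, U z ≠ ∞) (hk : Measurable k)
    (hΘ : Measurable Θ) (hΘfin : ∀ w, Θ w ≠ ∞) :
    ∫⁻ z, U z * ∫⁻ w, k (z, w) * Θ w = ∫⁻ w, (∫⁻ z, U z * k (z, w)) * Θ w := by
  have h1 : ∀ z, U z * ∫⁻ w, k (z, w) * Θ w = ∫⁻ w, U z * (k (z, w) * Θ w) := fun z =>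
    (lintegral_const_mul' _ _ (hUfin z)).symm
  have h2 : ∀ w, (∫⁻ z, U z * k (z, w)) * Θ w = ∫⁻ z, U z * (k (z, w) * Θ w) := fun w => by
    rw [← lintegral_mul_const' _ _ (hΘfin w)]
    exact lintegral_congr fun z => by ring
  simp_rw [h1, h2]
  have hmeas : AEMeasurable (uncurry fun z w => U z * (k (z, w) * Θ w))
      ((volume : Measure (ℝ × EuclideanSpace ℝ (Fin 3))).prod volume) := by
    have hU' : AEMeasurable (fun q : (ℝ × EuclideanSpace ℝ (Fin 3)) × (ℝ × EuclideanSpace ℝ (Fin 3)) =>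
        U q.1) ((volume : Measure (ℝ × EuclideanSpace ℝ (Fin 3))).prod volume) := hU.comp_fst
    have hΘ' : Measurable (fun q : (ℝ × EuclideanSpace ℝ (Fin 3)) × (ℝ × EuclideanSpace ℝ (Fin 3)) =>
        Θ q.2) := hΘ.comp measurable_snd
    exact hU'.mul ((hk.mul hΘ').aemeasurable)
  exact lintegral_lintegral_swap hmeas
set_option maxHeartbeats 400000 in -- buildfix (bf3-g26): 160k/180k FAIL, 200k PASS at accept time; line-neutral budget line
/-- **The dual pairing bound** (Lemarié-Rieusset 2016, §13.9 Step 3, (13.52), and the proof of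
Lemma 13.5, pp. 475–477, in dual form). Let `(u, p)` be a distributional solution of the
Navier–Stokes equations with viscosity `ν > 0` and force `f` on the region `Ω`
(`Fluid.IsDistributionalNSSolutionOn`), with `f` locally integrable and weakly divergence free on
`Ω`, and let `Q_{r₂}(z₀) ⊆ Ω`, `0 < r₃ < r₂`, `‖c‖ ≤ 1`. There are `C₀, C` such that for every
scalar test function `θ` on `Q_{r₃}(z₀)`

  `‖∫ θ ⟪u, c⟫‖ₑ ≤ C₀ ∫⁻ ‖θ‖ₑ + C ∫⁻ (𝓘₂(1_{Q₂}|f|) + 𝓘₁(1_{Q₂}|u|²)) ‖θ‖ₑ`,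

`Q₂ = Q_{r₂}(z₀)`, `𝓘_α` the parabolic Riesz potentials (`parabolicRieszPotential`): the
velocity on `Q₃` is dominated, in the sense of distributions, by a bounded function plus
`𝓘₂(1_{Q₂}|f|) + 𝓘₁(1_{Q₂}|u|²)` — the terms `𝓘₂(|φf|)` and `∑𝓘₁(φ|uⱼuₗ|)` of (13.52), all the
other printed terms being of lower order. [cite: LemarieRieusset2016, §13.9 Step 3 (13.52) p. 475; proof of Lemma 13.5 pp. 475–477] -/
theorem LemarieRieusset2016.dual_pairing_bound
    (hns : IsDistributionalNSSolutionOn Ω ν f u p) (hν : 0 < ν)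
    (hf : LocallyIntegrableOn (uncurry f) (Ω : Set (ℝ × EuclideanSpace ℝ (Fin 3))) volume)
    (hdivf : ∀ φ' : ℝ → EuclideanSpace ℝ (Fin 3) → ℝ, IsSpaceTimeTestOn Ω φ' →
      ∫ z in (Ω : Set (ℝ × EuclideanSpace ℝ (Fin 3))), ⟪f z.1 z.2, gradient (φ' z.1) z.2⟫ = 0)
    (hΩ : parabolicCylinderCentered r₂ z₀ ⊆ (Ω : Set (ℝ × EuclideanSpace ℝ (Fin 3))))
    (hr₃ : 0 < r₃) (hr₃₂ : r₃ < r₂) (c : EuclideanSpace ℝ (Fin 3)) (hc : ‖c‖ ≤ 1) :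
    ∃ C₀ C : ℝ≥0, ∀ θ : ℝ → EuclideanSpace ℝ (Fin 3) → ℝ,
      IsSpaceTimeTestOn (parabolicCylinderCenteredOpens r₃ z₀) θ →
      ‖∫ z : ℝ × EuclideanSpace ℝ (Fin 3), θ z.1 z.2 * ⟪u z.1 z.2, c⟫‖ₑ ≤
        (C₀ : ℝ≥0∞) * (∫⁻ z : ℝ × EuclideanSpace ℝ (Fin 3), ‖θ z.1 z.2‖ₑ) +
        (C : ℝ≥0∞) * ∫⁻ z : ℝ × EuclideanSpace ℝ (Fin 3), (parabolicRieszPotential 2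
              ((parabolicCylinderCentered r₂ z₀).indicator fun w => ‖f w.1 w.2‖ₑ) z +
            parabolicRieszPotential 1
              ((parabolicCylinderCentered r₂ z₀).indicator
                fun w => ‖u w.1 w.2‖ₑ * ‖u w.1 w.2‖ₑ) z) * ‖θ z.1 z.2‖ₑ := by
  classical
  /- ### radii, cylinders, the cut-off -/
  set ρ₁ : ℝ := (2 * r₃ + r₂) / 3 with hρ₁_def
  set ρ₂ : ℝ := (r₃ + 2 * r₂) / 3 with hρ₂_def
  have hρ₁ : r₃ < ρ₁ := by rw [hρ₁_def]; linarith
  have hρ₁₂ : ρ₁ < ρ₂ := by rw [hρ₁_def, hρ₂_def]; linarith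
  have hρ₂ : ρ₂ < r₂ := by rw [hρ₂_def]; linarith
  have hρ₁0 : 0 < ρ₁ := hr₃.trans hρ₁
  have hρ₂0 : 0 < ρ₂ := hρ₁0.trans hρ₁₂
  set Q₂ : Set (ℝ × EuclideanSpace ℝ (Fin 3)) := parabolicCylinderCentered r₂ z₀ with hQ₂_def
  set Q₃ : Set (ℝ × EuclideanSpace ℝ (Fin 3)) := parabolicCylinderCentered r₃ z₀ with hQ₃_def
  have hQ₂m : MeasurableSet Q₂ := (isOpen_parabolicCylinderCentered r₂ z₀).measurableSet
  set Kbox : Set (ℝ × EuclideanSpace ℝ (Fin 3)) := closedBall z₀.1 (ρ₂ ^ 2) ×ˢ closedBall z₀.2 ρ₂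
    with hKbox_def
  have hKboxQ₂ : Kbox ⊆ Q₂ := closedBox_subset_parabolicCylinderCentered hρ₂0.le hρ₂ z₀
  obtain ⟨φ, hφT, hφ01, hφK, hflat⟩ := exists_product_cutoff z₀ hρ₁0 hρ₁₂
  set K : Set (ℝ × EuclideanSpace ℝ (Fin 3)) := tsupport (uncurry φ) with hK_def
  have hKc : IsCompact K := hφT.hasCompactSupport
  have hKm : MeasurableSet K := hKc.measurableSet
  have hKQ₂ : K ⊆ Q₂ := hφK.trans hKboxQ₂
  have hKΩ : K ⊆ (Ω : Set (ℝ × EuclideanSpace ℝ (Fin 3))) := hKQ₂.trans hΩ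
  have hφ : IsSpaceTimeTestOn Ω φ := ⟨hφT.contDiff, hφT.hasCompactSupport, hKΩ⟩
  -- the standard frame
  set b : OrthonormalBasis (Fin 3) ℝ (EuclideanSpace ℝ (Fin 3)) := EuclideanSpace.basisFun (Fin 3) ℝ
    with hb_def
  have hb1 : ∀ i, ‖b i‖ ≤ 1 := fun i => (b.orthonormal.1 i).le
  /- ### sup bounds for the derivatives of the cut-off -/
  obtain ⟨Mt, hMt0, hMt⟩ := hφT.timeDeriv_top.exists_norm_le
  obtain ⟨MΔ, hMΔ0, hMΔ⟩ := hφT.laplacian_top.exists_norm_le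
  obtain ⟨Mc, hMc0, hMc⟩ := (hφT.fderiv_apply_top c).exists_norm_le
  have hM1ex : ∀ i : Fin 3, ∃ M : ℝ, 0 ≤ M ∧ ∀ t x, ‖fderiv ℝ (φ t) x (b i)‖ ≤ M := fun i =>
    (hφT.fderiv_apply_top (b i)).exists_norm_le
  choose M1 hM10 hM1 using hM1ex
  have hM2ex : ∀ i j : Fin 3, ∃ M : ℝ, 0 ≤ M ∧
      ∀ t x, ‖fderiv ℝ (fun y => fderiv ℝ (φ t) y (b i)) x (b j)‖ ≤ M := fun i j =>
    ((hφT.fderiv_apply_top (b i)).fderiv_apply_top (b j)).exists_norm_le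
  choose M2 hM20 hM2 using hM2ex
  /- ### the constants of the caloric fields (`CaloricDualTestFields`) -/
  have hA : 0 < ν * (ρ₂ ^ 2 + r₃ ^ 2) + 1 := by positivity
  have hR : 0 < ρ₂ + r₃ + 1 := by positivity
  have ha₀ : 0 < ν * (ρ₁ ^ 2 - r₃ ^ 2) := mul_pos hν (by nlinarith)
  have hd₀ : 0 < ρ₁ - r₃ := by linarith
  obtain ⟨Cη3, hCη3, Hη3⟩ := exists_enorm_heatDuhamelBack_le_parabolic (ν := ν) hν
  obtain ⟨Cη4, hCη4, Hη4⟩ := exists_enorm_fderiv_heatDuhamelBack_le_parabolic (ν := ν) hν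
  obtain ⟨CΞ4, hCΞ4, HΞ4⟩ := exists_enorm_fderiv2_heatDuhamelBack_newton_le_parabolic
    (r₀ := (1 : ℝ)) (r₁ := 2) one_pos one_lt_two hν hA hR
  obtain ⟨Bη, hBη0, HBη⟩ := exists_enorm_heatDuhamelBack_le_offDiag (ν := ν) hν ha₀ hd₀
  obtain ⟨Bη', hBη'0, HBη'⟩ := exists_enorm_fderiv_heatDuhamelBack_le_offDiag (ν := ν) hν ha₀ hd₀
  obtain ⟨BΞ, hBΞ0, HBΞ⟩ := exists_enorm_heatDuhamelBack_newton_le_offDiag (r₀ := (1 : ℝ)) (r₁ := 2)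
    one_pos one_lt_two hν c ha₀ hd₀
  have HBΞ'ex : ∀ i : Fin 3, ∃ B : ℝ, 0 ≤ B ∧ ∀ {g : ℝ → EuclideanSpace ℝ (Fin 3) → ℝ},
      IsSpaceTimeTestOn (⊤ : Opens (ℝ × EuclideanSpace ℝ (Fin 3))) g →
      ∀ (s : ℝ) (y : EuclideanSpace ℝ (Fin 3)),
        (∀ t x, g t x ≠ 0 → s < t → ν * (ρ₁ ^ 2 - r₃ ^ 2) ≤ ν * (t - s) ∨ ρ₁ - r₃ ≤ ‖y - x‖) →
        ‖fderiv ℝ (heatDuhamelBack ν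
            (fun t y => fderiv ℝ (newtonNearPotential 1 2 (g t)) y c) s) y (b i)‖ₑ ≤
          ENNReal.ofReal B * ∫⁻ w : ℝ × EuclideanSpace ℝ (Fin 3), ‖g w.1 w.2‖ₑ := fun i =>
    exists_enorm_fderiv_heatDuhamelBack_newton_le_offDiag one_pos one_lt_two hν (b i) c ha₀ hd₀
  choose BΞ' hBΞ'0 HBΞ' using HBΞ'ex
  obtain ⟨BL, hBL0, HBL⟩ := exists_enorm_heatDuhamelBack_farSmoothing_le (r₀ := (1 : ℝ)) (r₁ := 2)
    one_pos one_lt_two hν c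
  /- ### the data on the support of the cut-off -/
  have hu := hns.1
  have hu2 := hns.2.1
  have hp := hns.2.2.1
  have iu : IntegrableOn (uncurry u) K volume := hu.integrableOn_compact_subset hKΩ hKc
  have iu2 : IntegrableOn (fun z => ‖uncurry u z‖ ^ 2) K volume := hu2.integrableOn_compact_subset hKΩ hKc
  have ip : IntegrableOn (uncurry p) K volume := hp.integrableOn_compact_subset hKΩ hKc
  have iF : IntegrableOn (uncurry f) K volume := hf.integrableOn_compact_subset hKΩ hKc
  set D : ℝ × EuclideanSpace ℝ (Fin 3) → ℝ≥0∞ := K.indicator fun z =>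
    ‖u z.1 z.2‖ₑ + ‖u z.1 z.2‖ₑ * ‖u z.1 z.2‖ₑ + ‖p z.1 z.2‖ₑ + ‖f z.1 z.2‖ₑ with hD_def
  set U2 : ℝ × EuclideanSpace ℝ (Fin 3) → ℝ≥0∞ := K.indicator fun z => ‖u z.1 z.2‖ₑ * ‖u z.1 z.2‖ₑ
    with hU2_def
  set Ff : ℝ × EuclideanSpace ℝ (Fin 3) → ℝ≥0∞ := K.indicator fun z => ‖f z.1 z.2‖ₑ with hFf_def
  have hum : AEMeasurable (fun z : ℝ × EuclideanSpace ℝ (Fin 3) => ‖u z.1 z.2‖ₑ) (volume.restrict K) :=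
    iu.aestronglyMeasurable.aemeasurable.enorm
  have hpm : AEMeasurable (fun z : ℝ × EuclideanSpace ℝ (Fin 3) => ‖p z.1 z.2‖ₑ) (volume.restrict K) :=
    ip.aestronglyMeasurable.aemeasurable.enorm
  have hfm : AEMeasurable (fun z : ℝ × EuclideanSpace ℝ (Fin 3) => ‖f z.1 z.2‖ₑ) (volume.restrict K) :=
    iF.aestronglyMeasurable.aemeasurable.enorm
  have hDm : AEMeasurable D volume :=
    (aemeasurable_indicator_iff hKm).2 (((hum.add (hum.mul hum)).add hpm).add hfm)
  have hU2m : AEMeasurable U2 volume := (aemeasurable_indicator_iff hKm).2 (hum.mul hum)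
  have hFfm : AEMeasurable Ff volume := (aemeasurable_indicator_iff hKm).2 hfm
  -- finiteness of `∫⁻ D`
  have hDfin : ∫⁻ z, D z < ∞ := by
    rw [hD_def, lintegral_indicator hKm]
    have i1 : ∫⁻ z in K, ‖u z.1 z.2‖ₑ < ∞ := iu.2
    have i2 : ∫⁻ z in K, ‖u z.1 z.2‖ₑ * ‖u z.1 z.2‖ₑ < ∞ := by
      have h := iu2.2
      rw [hasFiniteIntegral_iff_enorm] at h
      refine lt_of_le_of_lt (lintegral_mono fun z => le_of_eq ?_) h
      rw [Real.enorm_eq_ofReal (sq_nonneg _), sq, ENNReal.ofReal_mul (norm_nonneg _), ofReal_norm]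
      rfl
    have i3 : ∫⁻ z in K, ‖p z.1 z.2‖ₑ < ∞ := ip.2
    have i4 : ∫⁻ z in K, ‖f z.1 z.2‖ₑ < ∞ := iF.2
    rw [lintegral_add_right' _ hfm, lintegral_add_right' _ hpm, lintegral_add_left' hum]
    exact ENNReal.add_lt_top.2 ⟨ENNReal.add_lt_top.2 ⟨ENNReal.add_lt_top.2 ⟨i1, i2⟩, i3⟩, i4⟩
  /- ### the constants -/
  -- coefficients of the cut-off terms (all multiplied by `∫⁻ ‖θ‖ₑ · ∫⁻ D`)
  set Γ : ℝ≥0∞ :=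
    ENNReal.ofReal (Mt + ν * MΔ) * ENNReal.ofReal Bη
      + ∑ i : Fin 3, ENNReal.ofReal (2 * ν * M1 i) * ENNReal.ofReal Bη'
      + ∑ i : Fin 3, ENNReal.ofReal (M1 i) * ENNReal.ofReal Bη
      + ENNReal.ofReal Mc * ENNReal.ofReal Bη
      + 1 * ENNReal.ofReal BL
      + ENNReal.ofReal MΔ * ENNReal.ofReal BΞ
      + ∑ i : Fin 3, ENNReal.ofReal (2 * M1 i) * ENNReal.ofReal (BΞ' i)
      + ∑ i : Fin 3, ∑ j : Fin 3, ENNReal.ofReal (M2 i j) * ENNReal.ofReal BΞ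
      + ∑ i : Fin 3, ∑ j : Fin 3, ENNReal.ofReal (2 * M1 j) * ENNReal.ofReal (BΞ' i) with hΓ_def
  have hΓfin : Γ < ∞ := by
    have hm : ∀ a b : ℝ, ENNReal.ofReal a * ENNReal.ofReal b < ∞ := fun a b =>
      ENNReal.mul_lt_top ENNReal.ofReal_lt_top ENNReal.ofReal_lt_top
    have h1 : (1 : ℝ≥0∞) * ENNReal.ofReal BL < ∞ := by rw [one_mul]; exact ENNReal.ofReal_lt_top
    simp only [hΓ_def, ENNReal.add_lt_top, ENNReal.sum_lt_top, Finset.mem_univ, forall_const, hm,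
      h1, and_self]
  /- ### the constants `C₀`, `C` -/
  refine ⟨(Γ * ∫⁻ z, D z).toNNReal, (3 * Cη4 + 9 * CΞ4 + Cη3).toNNReal, fun θ hθ => ?_⟩
  have hC₀ : (((Γ * ∫⁻ z, D z).toNNReal : ℝ≥0) : ℝ≥0∞) = Γ * ∫⁻ z, D z :=
    ENNReal.coe_toNNReal (ENNReal.mul_ne_top hΓfin.ne hDfin.ne)
  have hC : (((3 * Cη4 + 9 * CΞ4 + Cη3).toNNReal : ℝ≥0) : ℝ≥0∞) =
      ENNReal.ofReal (3 * Cη4 + 9 * CΞ4 + Cη3) := rfl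
  rw [hC₀, hC]
  /- ### the test function, its support, the kernels -/
  have hg : IsSpaceTimeTestOn (⊤ : Opens (ℝ × EuclideanSpace ℝ (Fin 3))) θ := hθ.mono le_top
  have hθQ₃ : ∀ t x, θ t x ≠ 0 → ((t, x) : ℝ × EuclideanSpace ℝ (Fin 3)) ∈ Q₃ := fun t x h =>
    hθ.tsupport_subset (subset_tsupport _ (show ((t, x) : ℝ × EuclideanSpace ℝ (Fin 3)) ∈
      support (uncurry θ) from h))
  have hQ₃Q₂ : Q₃ ⊆ Q₂ := parabolicCylinderCentered_mono hr₃.le hr₃₂.le z₀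
  set Sθ : ℝ≥0∞ := ∫⁻ w : ℝ × EuclideanSpace ℝ (Fin 3), ‖θ w.1 w.2‖ₑ with hSθ_def
  have hθm : Measurable fun w : ℝ × EuclideanSpace ℝ (Fin 3) => ‖θ w.1 w.2‖ₑ :=
    hg.continuous_uncurry.measurable.enorm
  set k₄ : (ℝ × EuclideanSpace ℝ (Fin 3)) × (ℝ × EuclideanSpace ℝ (Fin 3)) → ℝ≥0∞ := fun q =>
    (ENNReal.ofReal (parabolicDist q.1 q.2) ^ (4 : ℝ))⁻¹ with hk₄_def
  set k₃ : (ℝ × EuclideanSpace ℝ (Fin 3)) × (ℝ × EuclideanSpace ℝ (Fin 3)) → ℝ≥0∞ := fun q =>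
    (ENNReal.ofReal (parabolicDist q.1 q.2) ^ (3 : ℝ))⁻¹ with hk₃_def
  have hk₄m : Measurable k₄ := by
    have h := measurable_parabolicRieszKernel 1
    rwa [show ((5 : ℝ) - 1) = 4 by norm_num] at h
  have hk₃m : Measurable k₃ := by
    have h := measurable_parabolicRieszKernel 2
    rwa [show ((5 : ℝ) - 2) = 3 by norm_num] at h
  set K₄ : ℝ × EuclideanSpace ℝ (Fin 3) → ℝ≥0∞ := fun z => ∫⁻ w, k₄ (z, w) * ‖θ w.1 w.2‖ₑ
    with hK₄_def
  set K₃ : ℝ × EuclideanSpace ℝ (Fin 3) → ℝ≥0∞ := fun z => ∫⁻ w, k₃ (z, w) * ‖θ w.1 w.2‖ₑ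
    with hK₃_def
  have hK₄m : Measurable K₄ := (hk₄m.mul (hθm.comp measurable_snd)).lintegral_prod_right'
  have hK₃m : Measurable K₃ := (hk₃m.mul (hθm.comp measurable_snd)).lintegral_prod_right'
  /- ### the caloric fields and the master identity -/
  set η : ℝ → EuclideanSpace ℝ (Fin 3) → ℝ := heatDuhamelBack ν θ with hη_def
  set Ξ : ℝ → EuclideanSpace ℝ (Fin 3) → ℝ :=
    heatDuhamelBack ν (fun t y => fderiv ℝ (newtonNearPotential 1 2 (θ t)) y c) with hΞ_def
  set L : ℝ → EuclideanSpace ℝ (Fin 3) → ℝ :=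
    heatDuhamelBack ν (fun t y => newtonFarSmoothing 1 2 (fun y' => fderiv ℝ (θ t) y' c) y)
    with hL_def
  obtain ⟨-, -, main⟩ := integral_cutoff_mul_test_mul_inner_eq_nu (c := c) hns hν hf hdivf hφ hg
    one_pos one_lt_two b hη_def hΞ_def hL_def
  -- the left-hand side is `∫ θ u_c`
  have hLHS : ∫ z in (Ω : Set (ℝ × EuclideanSpace ℝ (Fin 3))),
      φ z.1 z.2 * θ z.1 z.2 * ⟪u z.1 z.2, c⟫ =
      ∫ z : ℝ × EuclideanSpace ℝ (Fin 3), θ z.1 z.2 * ⟪u z.1 z.2, c⟫ := by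
    have h1 : ∀ z : ℝ × EuclideanSpace ℝ (Fin 3),
        φ z.1 z.2 * θ z.1 z.2 * ⟪u z.1 z.2, c⟫ = θ z.1 z.2 * ⟪u z.1 z.2, c⟫ := by
      intro z
      by_cases hz : θ z.1 z.2 = 0
      · rw [hz]; ring
      · have hzQ := hθQ₃ z.1 z.2 hz
        rw [mem_parabolicCylinderCentered] at hzQ
        have hsq : r₃ ^ 2 < ρ₁ ^ 2 := by nlinarith
        have hflatz := (hflat z (abs_sub_lt_iff.2 ⟨by linarith [hzQ.1.2], by linarith [hzQ.1.1]⟩)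
          (hzQ.2.trans hρ₁)).1
        rw [hflatz, one_mul]
    simp_rw [h1]
    refine setIntegral_eq_integral_of_forall_compl_eq_zero fun z hz => ?_
    have : θ z.1 z.2 = 0 := by
      by_contra h
      exact hz (hΩ (hQ₃Q₂ (hθQ₃ z.1 z.2 h)))
    rw [this, zero_mul]
  rw [hLHS] at main
  rw [main]
  /- ### geometry seen from the cut-off -/
  have hsep : ∀ z : ℝ × EuclideanSpace ℝ (Fin 3), (ρ₁ ^ 2 ≤ |z.1 - z₀.1| ∨ ρ₁ ≤ dist z.2 z₀.2) →
      ∀ t x, θ t x ≠ 0 → z.1 < t → ν * (ρ₁ ^ 2 - r₃ ^ 2) ≤ ν * (t - z.1) ∨ ρ₁ - r₃ ≤ ‖z.2 - x‖ :=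
    fun z hz t x h hst => parabolic_separation hν hr₃ hρ₁ hz (hθQ₃ t x h) hst
  have hrange : ∀ z ∈ K, ∀ t x, θ t x ≠ 0 → z.1 < t →
      ν * (t - z.1) ≤ ν * (ρ₂ ^ 2 + r₃ ^ 2) + 1 ∧ ‖z.2 - x‖ ≤ ρ₂ + r₃ + 1 :=
    fun z hz t x h _ => by
    obtain ⟨h1, h2⟩ := parabolic_range (ν := ν) (r₃ := r₃) hν (hφK hz) (hθQ₃ t x h)
    exact ⟨by linarith, by linarith⟩
  -- trichotomy: flat, off the support, or in the separated part of the support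
  have tri : ∀ z : ℝ × EuclideanSpace ℝ (Fin 3),
      (|z.1 - z₀.1| < ρ₁ ^ 2 ∧ dist z.2 z₀.2 < ρ₁) ∨ z ∉ K ∨
        (z ∈ K ∧ (ρ₁ ^ 2 ≤ |z.1 - z₀.1| ∨ ρ₁ ≤ dist z.2 z₀.2)) := by
    intro z
    by_cases h1 : |z.1 - z₀.1| < ρ₁ ^ 2 ∧ dist z.2 z₀.2 < ρ₁
    · exact Or.inl h1
    · by_cases h2 : z ∈ K
      · refine Or.inr (Or.inr ⟨h2, ?_⟩)
        rcases not_and_or.1 h1 with h | h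
        · exact Or.inl (not_lt.1 h)
        · exact Or.inr (not_lt.1 h)
      · exact Or.inr (Or.inl h2)
  /- ### pointwise facts on the cut-off and the data -/
  have zφ : ∀ z : ℝ × EuclideanSpace ℝ (Fin 3), z ∉ K → φ z.1 z.2 = 0 := fun z hz =>
    show uncurry φ z = 0 from image_eq_zero_of_notMem_tsupport hz
  have eφ : ∀ z : ℝ × EuclideanSpace ℝ (Fin 3), ‖φ z.1 z.2‖ₑ ≤ 1 := fun z =>
    enorm_le_one_of_mem_unit (hφ01 z.1 z.2).1 (hφ01 z.1 z.2).2
  have eφ' : ∀ z : ℝ × EuclideanSpace ℝ (Fin 3), ‖-φ z.1 z.2‖ₑ ≤ 1 := fun z => by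
    rw [enorm_neg]; exact eφ z
  have hDz : ∀ z ∈ K, D z = ‖u z.1 z.2‖ₑ + ‖u z.1 z.2‖ₑ * ‖u z.1 z.2‖ₑ + ‖p z.1 z.2‖ₑ + ‖f z.1 z.2‖ₑ :=
    fun z hz => indicator_of_mem hz _
  have hDu : ∀ z ∈ K, ∀ a : EuclideanSpace ℝ (Fin 3), ‖a‖ ≤ 1 → ‖(⟪u z.1 z.2, a⟫ : ℝ)‖ₑ ≤ D z :=
    fun z hz a ha => by
    rw [hDz z hz]
    calc ‖(⟪u z.1 z.2, a⟫ : ℝ)‖ₑ ≤ ‖u z.1 z.2‖ₑ := enorm_inner_le_enorm_of_norm_le_one _ ha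
      _ ≤ ‖u z.1 z.2‖ₑ + ‖u z.1 z.2‖ₑ * ‖u z.1 z.2‖ₑ + ‖p z.1 z.2‖ₑ + ‖f z.1 z.2‖ₑ := by
          rw [add_assoc, add_assoc]; exact le_self_add
  have hDuu : ∀ z ∈ K, ∀ a a' : EuclideanSpace ℝ (Fin 3), ‖a‖ ≤ 1 → ‖a'‖ ≤ 1 →
      ‖(⟪u z.1 z.2, a⟫ : ℝ) * ⟪u z.1 z.2, a'⟫‖ₑ ≤ D z := fun z hz a a' ha ha' => by
    rw [hDz z hz]
    calc ‖(⟪u z.1 z.2, a⟫ : ℝ) * ⟪u z.1 z.2, a'⟫‖ₑ ≤ ‖u z.1 z.2‖ₑ * ‖u z.1 z.2‖ₑ :=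
          enorm_inner_mul_inner_le _ ha ha'
      _ ≤ ‖u z.1 z.2‖ₑ + ‖u z.1 z.2‖ₑ * ‖u z.1 z.2‖ₑ + ‖p z.1 z.2‖ₑ + ‖f z.1 z.2‖ₑ := by
          calc ‖u z.1 z.2‖ₑ * ‖u z.1 z.2‖ₑ ≤ ‖u z.1 z.2‖ₑ + ‖u z.1 z.2‖ₑ * ‖u z.1 z.2‖ₑ := le_add_self
            _ ≤ _ := by rw [add_assoc _ (‖p z.1 z.2‖ₑ)]; exact le_self_add
  have hDp : ∀ z ∈ K, ‖p z.1 z.2‖ₑ ≤ D z := fun z hz => by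
    rw [hDz z hz]
    calc ‖p z.1 z.2‖ₑ ≤ ‖u z.1 z.2‖ₑ + ‖u z.1 z.2‖ₑ * ‖u z.1 z.2‖ₑ + ‖p z.1 z.2‖ₑ := le_add_self
      _ ≤ _ := le_self_add
  have hU2uu : ∀ z ∈ K, ∀ a a' : EuclideanSpace ℝ (Fin 3), ‖a‖ ≤ 1 → ‖a'‖ ≤ 1 →
      ‖(⟪u z.1 z.2, a⟫ : ℝ) * ⟪u z.1 z.2, a'⟫‖ₑ ≤ U2 z := fun z hz a a' ha ha' => by
    rw [show U2 z = ‖u z.1 z.2‖ₑ * ‖u z.1 z.2‖ₑ from indicator_of_mem hz _]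
    exact enorm_inner_mul_inner_le _ ha ha'
  have hFf : ∀ z ∈ K, ‖(⟪f z.1 z.2, c⟫ : ℝ)‖ₑ ≤ Ff z := fun z hz => by
    rw [show Ff z = ‖f z.1 z.2‖ₑ from indicator_of_mem hz _]
    exact enorm_inner_le_enorm_of_norm_le_one _ hc
  -- vanishing of the derivatives of the cut-off: flat region or off the support
  have vφt : ∀ z : ℝ × EuclideanSpace ℝ (Fin 3),
      (|z.1 - z₀.1| < ρ₁ ^ 2 ∧ dist z.2 z₀.2 < ρ₁) ∨ z ∉ K →
        timeDeriv φ z.1 z.2 + ν * (Δ (φ z.1)) z.2 = 0 := by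
    rintro z (hfl | hzK)
    · obtain ⟨-, h1, -, h2, -⟩ := hflat z hfl.1 hfl.2
      rw [h1, h2, mul_zero, add_zero]
    · rw [IsSpaceTimeTestOn.timeDeriv_eq_zero_of_notMem hzK, laplacian_slice_eq_zero_of_notMem_tsupport hzK,
        mul_zero, add_zero]
  have vφi : ∀ z : ℝ × EuclideanSpace ℝ (Fin 3),
      (|z.1 - z₀.1| < ρ₁ ^ 2 ∧ dist z.2 z₀.2 < ρ₁) ∨ z ∉ K →
        ∀ v, fderiv ℝ (φ z.1) z.2 v = 0 := by
    rintro z (hfl | hzK) v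
    · obtain ⟨-, -, h1, -, -⟩ := hflat z hfl.1 hfl.2
      rw [h1]; rfl
    · rw [IsSpaceTimeTestOn.fderiv_slice_eq_zero_of_notMem hzK]; rfl
  have vφΔ : ∀ z : ℝ × EuclideanSpace ℝ (Fin 3),
      (|z.1 - z₀.1| < ρ₁ ^ 2 ∧ dist z.2 z₀.2 < ρ₁) ∨ z ∉ K → (Δ (φ z.1)) z.2 = 0 := by
    rintro z (hfl | hzK)
    · exact (hflat z hfl.1 hfl.2).2.2.2.1
    · exact laplacian_slice_eq_zero_of_notMem_tsupport hzK
  have vφij : ∀ z : ℝ × EuclideanSpace ℝ (Fin 3),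
      (|z.1 - z₀.1| < ρ₁ ^ 2 ∧ dist z.2 z₀.2 < ρ₁) ∨ z ∉ K →
        ∀ v w, fderiv ℝ (fun y => fderiv ℝ (φ z.1) y v) z.2 w = 0 := by
    rintro z (hfl | hzK) v w
    · exact (hflat z hfl.1 hfl.2).2.2.2.2 v w
    · exact fderiv_fderiv_slice_eq_zero_of_notMem_tsupport hzK v w
  /- ### the pointwise bounds of the twelve terms -/
  have hAV : ∀ z : ℝ × EuclideanSpace ℝ (Fin 3),
      ‖(timeDeriv φ z.1 z.2 + ν * (Δ (φ z.1)) z.2) * ⟪u z.1 z.2, c⟫ * η z.1 z.2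
        + ∑ i, (2 * ν * fderiv ℝ (φ z.1) z.2 (b i)) * ⟪u z.1 z.2, c⟫ * fderiv ℝ (η z.1) z.2 (b i)
        + ∑ i, fderiv ℝ (φ z.1) z.2 (b i) * (⟪u z.1 z.2, b i⟫ * ⟪u z.1 z.2, c⟫) * η z.1 z.2
        + ∑ i, φ z.1 z.2 * (⟪u z.1 z.2, b i⟫ * ⟪u z.1 z.2, c⟫) * fderiv ℝ (η z.1) z.2 (b i)
        + fderiv ℝ (φ z.1) z.2 c * p z.1 z.2 * η z.1 z.2
        + φ z.1 z.2 * ⟪f z.1 z.2, c⟫ * η z.1 z.2‖ₑ ≤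
      ENNReal.ofReal (Mt + ν * MΔ) * ENNReal.ofReal Bη * (Sθ * D z)
        + (∑ i : Fin 3, ENNReal.ofReal (2 * ν * M1 i) * ENNReal.ofReal Bη') * (Sθ * D z)
        + (∑ i : Fin 3, ENNReal.ofReal (M1 i) * ENNReal.ofReal Bη) * (Sθ * D z)
        + 3 * (ENNReal.ofReal Cη4 * (U2 z * K₄ z))
        + ENNReal.ofReal Mc * ENNReal.ofReal Bη * (Sθ * D z)
        + ENNReal.ofReal Cη3 * (Ff z * K₃ z) := by
    intro z
    set A1 : ℝ := (timeDeriv φ z.1 z.2 + ν * (Δ (φ z.1)) z.2) * ⟪u z.1 z.2, c⟫ * η z.1 z.2 with hA1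
    set A2 : Fin 3 → ℝ := fun i =>
      (2 * ν * fderiv ℝ (φ z.1) z.2 (b i)) * ⟪u z.1 z.2, c⟫ * fderiv ℝ (η z.1) z.2 (b i) with hA2
    set A3 : Fin 3 → ℝ := fun i =>
      fderiv ℝ (φ z.1) z.2 (b i) * (⟪u z.1 z.2, b i⟫ * ⟪u z.1 z.2, c⟫) * η z.1 z.2 with hA3
    set A4 : Fin 3 → ℝ := fun i =>
      φ z.1 z.2 * (⟪u z.1 z.2, b i⟫ * ⟪u z.1 z.2, c⟫) * fderiv ℝ (η z.1) z.2 (b i) with hA4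
    set A5 : ℝ := fderiv ℝ (φ z.1) z.2 c * p z.1 z.2 * η z.1 z.2 with hA5
    set A6 : ℝ := φ z.1 z.2 * ⟪f z.1 z.2, c⟫ * η z.1 z.2 with hA6
    -- the six families
    have T1 : ‖A1‖ₑ ≤ ENNReal.ofReal (Mt + ν * MΔ) * D z * (ENNReal.ofReal Bη * Sθ) := by
      refine enorm_mul_mul_le_of_bounds ?_
      rcases tri z with hfl | hzK | ⟨hzK, hnf⟩
      · exact Or.inl (vφt z (Or.inl hfl))
      · exact Or.inl (vφt z (Or.inr hzK))
      · refine Or.inr ⟨enorm_le_ofReal_of_abs_le ?_, hDu z hzK c hc, HBη hg z.1 z.2 (hsep z hnf)⟩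
        calc |timeDeriv φ z.1 z.2 + ν * (Δ (φ z.1)) z.2|
            ≤ |timeDeriv φ z.1 z.2| + |ν * (Δ (φ z.1)) z.2| := abs_add_le _ _
          _ ≤ Mt + ν * MΔ := by
              rw [abs_mul, abs_of_pos hν]
              have h1 := hMt z.1 z.2
              have h2 := hMΔ z.1 z.2
              rw [Real.norm_eq_abs] at h1 h2
              exact add_le_add h1 (mul_le_mul_of_nonneg_left h2 hν.le)
    have T2 : ∀ i, ‖A2 i‖ₑ ≤ ENNReal.ofReal (2 * ν * M1 i) * D z * (ENNReal.ofReal Bη' * Sθ) := by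
      intro i
      refine enorm_mul_mul_le_of_bounds ?_
      rcases tri z with hfl | hzK | ⟨hzK, hnf⟩
      · exact Or.inl (by rw [vφi z (Or.inl hfl), mul_zero])
      · exact Or.inl (by rw [vφi z (Or.inr hzK), mul_zero])
      · refine Or.inr ⟨enorm_le_ofReal_of_abs_le ?_, hDu z hzK c hc,
          HBη' hg z.1 z.2 (b i) (hb1 i) (hsep z hnf)⟩
        rw [abs_mul, abs_of_pos (by positivity : (0 : ℝ) < 2 * ν)]
        have h1 := hM1 i z.1 z.2
        rw [Real.norm_eq_abs] at h1
        exact mul_le_mul_of_nonneg_left h1 (by positivity)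
    have T3 : ∀ i, ‖A3 i‖ₑ ≤ ENNReal.ofReal (M1 i) * D z * (ENNReal.ofReal Bη * Sθ) := by
      intro i
      refine enorm_mul_mul_le_of_bounds ?_
      rcases tri z with hfl | hzK | ⟨hzK, hnf⟩
      · exact Or.inl (vφi z (Or.inl hfl) _)
      · exact Or.inl (vφi z (Or.inr hzK) _)
      · refine Or.inr ⟨enorm_le_ofReal_of_abs_le ?_, hDuu z hzK _ _ (hb1 i) hc,
          HBη hg z.1 z.2 (hsep z hnf)⟩
        have h1 := hM1 i z.1 z.2
        rwa [Real.norm_eq_abs] at h1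
    have T4 : ∀ i, ‖A4 i‖ₑ ≤ 1 * U2 z * (ENNReal.ofReal Cη4 * K₄ z) := by
      intro i
      refine enorm_mul_mul_le_of_bounds ?_
      by_cases hzK : z ∈ K
      · exact Or.inr ⟨eφ z, hU2uu z hzK _ _ (hb1 i) hc, Hη4 hg z.1 z.2 (b i) (hb1 i)⟩
      · exact Or.inl (zφ z hzK)
    have T5 : ‖A5‖ₑ ≤ ENNReal.ofReal Mc * D z * (ENNReal.ofReal Bη * Sθ) := by
      refine enorm_mul_mul_le_of_bounds ?_
      rcases tri z with hfl | hzK | ⟨hzK, hnf⟩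
      · exact Or.inl (vφi z (Or.inl hfl) _)
      · exact Or.inl (vφi z (Or.inr hzK) _)
      · refine Or.inr ⟨enorm_le_ofReal_of_abs_le ?_, hDp z hzK, HBη hg z.1 z.2 (hsep z hnf)⟩
        have h1 := hMc z.1 z.2
        rwa [Real.norm_eq_abs] at h1
    have T6 : ‖A6‖ₑ ≤ 1 * Ff z * (ENNReal.ofReal Cη3 * K₃ z) := by
      refine enorm_mul_mul_le_of_bounds ?_
      by_cases hzK : z ∈ K
      · exact Or.inr ⟨eφ z, hFf z hzK, Hη3 hg z.1 z.2⟩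
      · exact Or.inl (zφ z hzK)
    -- reshaped
    have e1 : ‖A1‖ₑ ≤ ENNReal.ofReal (Mt + ν * MΔ) * ENNReal.ofReal Bη * (Sθ * D z) :=
      T1.trans (le_of_eq (by ring))
    have e2 : ‖∑ i, A2 i‖ₑ ≤ (∑ i : Fin 3, ENNReal.ofReal (2 * ν * M1 i) * ENNReal.ofReal Bη') * (Sθ * D z) := by
      rw [Finset.sum_mul]
      exact (enorm_sum_le _ _).trans (Finset.sum_le_sum fun i _ => (T2 i).trans (le_of_eq (by ring)))
    have e3 : ‖∑ i, A3 i‖ₑ ≤ (∑ i : Fin 3, ENNReal.ofReal (M1 i) * ENNReal.ofReal Bη) * (Sθ * D z) := by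
      rw [Finset.sum_mul]
      exact (enorm_sum_le _ _).trans (Finset.sum_le_sum fun i _ => (T3 i).trans (le_of_eq (by ring)))
    have e4 : ‖∑ i, A4 i‖ₑ ≤ 3 * (ENNReal.ofReal Cη4 * (U2 z * K₄ z)) := by
      calc ‖∑ i, A4 i‖ₑ ≤ ∑ i, ‖A4 i‖ₑ := enorm_sum_le _ _
        _ ≤ ∑ _i : Fin 3, ENNReal.ofReal Cη4 * (U2 z * K₄ z) :=
            Finset.sum_le_sum fun i _ => (T4 i).trans (le_of_eq (by ring))
        _ = 3 * (ENNReal.ofReal Cη4 * (U2 z * K₄ z)) := by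
            rw [Finset.sum_const, Finset.card_univ, Fintype.card_fin, nsmul_eq_mul]; norm_num
    have e5 : ‖A5‖ₑ ≤ ENNReal.ofReal Mc * ENNReal.ofReal Bη * (Sθ * D z) :=
      T5.trans (le_of_eq (by ring))
    have e6 : ‖A6‖ₑ ≤ ENNReal.ofReal Cη3 * (Ff z * K₃ z) := T6.trans (le_of_eq (by ring))
    exact (enorm_add_six_le _ _ _ _ _ _).trans
      (add_le_add (add_le_add (add_le_add (add_le_add (add_le_add e1 e2) e3) e4) e5) e6)
  have hBV : ∀ z : ℝ × EuclideanSpace ℝ (Fin 3),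
      ‖φ z.1 z.2 * p z.1 z.2 * L z.1 z.2
        + (-(Δ (φ z.1)) z.2) * p z.1 z.2 * Ξ z.1 z.2
        + ∑ i, (-(2 * fderiv ℝ (φ z.1) z.2 (b i))) * p z.1 z.2 * fderiv ℝ (Ξ z.1) z.2 (b i)
        + ∑ i, ∑ j, (-(φ z.1 z.2)) * (⟪u z.1 z.2, b i⟫ * ⟪u z.1 z.2, b j⟫) *
            fderiv ℝ (fun y => fderiv ℝ (Ξ z.1) y (b i)) z.2 (b j)
        + ∑ i, ∑ j, (-(fderiv ℝ (fun y => fderiv ℝ (φ z.1) y (b i)) z.2 (b j))) *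
            (⟪u z.1 z.2, b i⟫ * ⟪u z.1 z.2, b j⟫) * Ξ z.1 z.2
        + ∑ i, ∑ j, (-(2 * fderiv ℝ (φ z.1) z.2 (b j))) * (⟪u z.1 z.2, b j⟫ * ⟪u z.1 z.2, b i⟫) *
            fderiv ℝ (Ξ z.1) z.2 (b i)‖ₑ ≤
      1 * ENNReal.ofReal BL * (Sθ * D z)
        + ENNReal.ofReal MΔ * ENNReal.ofReal BΞ * (Sθ * D z)
        + (∑ i : Fin 3, ENNReal.ofReal (2 * M1 i) * ENNReal.ofReal (BΞ' i)) * (Sθ * D z)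
        + 9 * (ENNReal.ofReal CΞ4 * (U2 z * K₄ z))
        + (∑ i : Fin 3, ∑ j : Fin 3, ENNReal.ofReal (M2 i j) * ENNReal.ofReal BΞ) * (Sθ * D z)
        + (∑ i : Fin 3, ∑ j : Fin 3, ENNReal.ofReal (2 * M1 j) * ENNReal.ofReal (BΞ' i)) *
            (Sθ * D z) := by
    intro z
    set B1 : ℝ := φ z.1 z.2 * p z.1 z.2 * L z.1 z.2 with hB1
    set B2 : ℝ := (-(Δ (φ z.1)) z.2) * p z.1 z.2 * Ξ z.1 z.2 with hB2
    set B3 : Fin 3 → ℝ := fun i =>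
      (-(2 * fderiv ℝ (φ z.1) z.2 (b i))) * p z.1 z.2 * fderiv ℝ (Ξ z.1) z.2 (b i) with hB3
    set B4 : Fin 3 → Fin 3 → ℝ := fun i j => (-(φ z.1 z.2)) * (⟪u z.1 z.2, b i⟫ * ⟪u z.1 z.2, b j⟫) *
      fderiv ℝ (fun y => fderiv ℝ (Ξ z.1) y (b i)) z.2 (b j) with hB4
    set B5 : Fin 3 → Fin 3 → ℝ := fun i j =>
      (-(fderiv ℝ (fun y => fderiv ℝ (φ z.1) y (b i)) z.2 (b j))) *
        (⟪u z.1 z.2, b i⟫ * ⟪u z.1 z.2, b j⟫) * Ξ z.1 z.2 with hB5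
    set B6 : Fin 3 → Fin 3 → ℝ := fun i j =>
      (-(2 * fderiv ℝ (φ z.1) z.2 (b j))) * (⟪u z.1 z.2, b j⟫ * ⟪u z.1 z.2, b i⟫) *
        fderiv ℝ (Ξ z.1) z.2 (b i) with hB6
    have S1 : ‖B1‖ₑ ≤ 1 * D z * (ENNReal.ofReal BL * Sθ) := by
      refine enorm_mul_mul_le_of_bounds ?_
      by_cases hzK : z ∈ K
      · exact Or.inr ⟨eφ z, hDp z hzK, HBL hg z.1 z.2⟩
      · exact Or.inl (zφ z hzK)
    have S2 : ‖B2‖ₑ ≤ ENNReal.ofReal MΔ * D z * (ENNReal.ofReal BΞ * Sθ) := by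
      refine enorm_mul_mul_le_of_bounds ?_
      rcases tri z with hfl | hzK | ⟨hzK, hnf⟩
      · exact Or.inl (by rw [vφΔ z (Or.inl hfl), neg_zero])
      · exact Or.inl (by rw [vφΔ z (Or.inr hzK), neg_zero])
      · refine Or.inr ⟨?_, hDp z hzK, HBΞ hg z.1 z.2 (hsep z hnf)⟩
        rw [enorm_neg]
        refine enorm_le_ofReal_of_abs_le ?_
        have h1 := hMΔ z.1 z.2
        rwa [Real.norm_eq_abs] at h1
    have S3 : ∀ i, ‖B3 i‖ₑ ≤ ENNReal.ofReal (2 * M1 i) * D z * (ENNReal.ofReal (BΞ' i) * Sθ) := by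
      intro i
      refine enorm_mul_mul_le_of_bounds ?_
      rcases tri z with hfl | hzK | ⟨hzK, hnf⟩
      · exact Or.inl (by rw [vφi z (Or.inl hfl), mul_zero, neg_zero])
      · exact Or.inl (by rw [vφi z (Or.inr hzK), mul_zero, neg_zero])
      · refine Or.inr ⟨?_, hDp z hzK, HBΞ' i hg z.1 z.2 (hsep z hnf)⟩
        rw [enorm_neg]
        refine enorm_le_ofReal_of_abs_le ?_
        rw [abs_mul, abs_two]
        have h1 := hM1 i z.1 z.2
        rw [Real.norm_eq_abs] at h1
        linarith
    have S4 : ∀ i j, ‖B4 i j‖ₑ ≤ 1 * U2 z * (ENNReal.ofReal CΞ4 * K₄ z) := by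
      intro i j
      refine enorm_mul_mul_le_of_bounds ?_
      by_cases hzK : z ∈ K
      · exact Or.inr ⟨eφ' z, hU2uu z hzK _ _ (hb1 i) (hb1 j),
          HΞ4 hg (b j) (b i) c (hb1 j) (hb1 i) hc z.1 z.2 (hrange z hzK)⟩
      · exact Or.inl (by rw [zφ z hzK, neg_zero])
    have S5 : ∀ i j, ‖B5 i j‖ₑ ≤ ENNReal.ofReal (M2 i j) * D z * (ENNReal.ofReal BΞ * Sθ) := by
      intro i j
      refine enorm_mul_mul_le_of_bounds ?_
      rcases tri z with hfl | hzK | ⟨hzK, hnf⟩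
      · exact Or.inl (by rw [vφij z (Or.inl hfl), neg_zero])
      · exact Or.inl (by rw [vφij z (Or.inr hzK), neg_zero])
      · refine Or.inr ⟨?_, hDuu z hzK _ _ (hb1 i) (hb1 j), HBΞ hg z.1 z.2 (hsep z hnf)⟩
        rw [enorm_neg]
        refine enorm_le_ofReal_of_abs_le ?_
        have h1 := hM2 i j z.1 z.2
        rwa [Real.norm_eq_abs] at h1
    have S6 : ∀ i j, ‖B6 i j‖ₑ ≤ ENNReal.ofReal (2 * M1 j) * D z * (ENNReal.ofReal (BΞ' i) * Sθ) := by
      intro i j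
      refine enorm_mul_mul_le_of_bounds ?_
      rcases tri z with hfl | hzK | ⟨hzK, hnf⟩
      · exact Or.inl (by rw [vφi z (Or.inl hfl), mul_zero, neg_zero])
      · exact Or.inl (by rw [vφi z (Or.inr hzK), mul_zero, neg_zero])
      · refine Or.inr ⟨?_, hDuu z hzK _ _ (hb1 j) (hb1 i), HBΞ' i hg z.1 z.2 (hsep z hnf)⟩
        rw [enorm_neg]
        refine enorm_le_ofReal_of_abs_le ?_
        rw [abs_mul, abs_two]
        have h1 := hM1 j z.1 z.2
        rw [Real.norm_eq_abs] at h1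
        linarith
    -- reshaped
    have e1 : ‖B1‖ₑ ≤ 1 * ENNReal.ofReal BL * (Sθ * D z) := S1.trans (le_of_eq (by ring))
    have e2 : ‖B2‖ₑ ≤ ENNReal.ofReal MΔ * ENNReal.ofReal BΞ * (Sθ * D z) :=
      S2.trans (le_of_eq (by ring))
    have e3 : ‖∑ i, B3 i‖ₑ ≤
        (∑ i : Fin 3, ENNReal.ofReal (2 * M1 i) * ENNReal.ofReal (BΞ' i)) * (Sθ * D z) := by
      rw [Finset.sum_mul]
      exact (enorm_sum_le _ _).trans (Finset.sum_le_sum fun i _ => (S3 i).trans (le_of_eq (by ring)))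
    have e4 : ‖∑ i, ∑ j, B4 i j‖ₑ ≤ 9 * (ENNReal.ofReal CΞ4 * (U2 z * K₄ z)) := by
      calc ‖∑ i, ∑ j, B4 i j‖ₑ ≤ ∑ i, ‖∑ j, B4 i j‖ₑ := enorm_sum_le _ _
        _ ≤ ∑ i, ∑ j, ‖B4 i j‖ₑ := Finset.sum_le_sum fun i _ => enorm_sum_le _ _
        _ ≤ ∑ _i : Fin 3, ∑ _j : Fin 3, ENNReal.ofReal CΞ4 * (U2 z * K₄ z) :=
            Finset.sum_le_sum fun i _ => Finset.sum_le_sum fun j _ =>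
              (S4 i j).trans (le_of_eq (by ring))
        _ = 9 * (ENNReal.ofReal CΞ4 * (U2 z * K₄ z)) := by
            rw [Finset.sum_const, Finset.card_univ, Fintype.card_fin, Finset.sum_const,
              Finset.card_univ, Fintype.card_fin, smul_smul, nsmul_eq_mul]
            norm_num
    have e5 : ‖∑ i, ∑ j, B5 i j‖ₑ ≤
        (∑ i : Fin 3, ∑ j : Fin 3, ENNReal.ofReal (M2 i j) * ENNReal.ofReal BΞ) * (Sθ * D z) := by
      rw [Finset.sum_mul]
      refine (enorm_sum_le _ _).trans (Finset.sum_le_sum fun i _ => ?_)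
      rw [Finset.sum_mul]
      exact (enorm_sum_le _ _).trans (Finset.sum_le_sum fun j _ => (S5 i j).trans (le_of_eq (by ring)))
    have e6 : ‖∑ i, ∑ j, B6 i j‖ₑ ≤
        (∑ i : Fin 3, ∑ j : Fin 3, ENNReal.ofReal (2 * M1 j) * ENNReal.ofReal (BΞ' i)) * (Sθ * D z) := by
      rw [Finset.sum_mul]
      refine (enorm_sum_le _ _).trans (Finset.sum_le_sum fun i _ => ?_)
      rw [Finset.sum_mul]
      exact (enorm_sum_le _ _).trans (Finset.sum_le_sum fun j _ => (S6 i j).trans (le_of_eq (by ring)))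
    exact (enorm_add_six_le _ _ _ _ _ _).trans
      (add_le_add (add_le_add (add_le_add (add_le_add (add_le_add e1 e2) e3) e4) e5) e6)
  /- ### integrate: `‖∫AV + ∫BV‖ ≤ ∫⁻ (pointwise bound)` -/
  have hpt : ∀ z : ℝ × EuclideanSpace ℝ (Fin 3),
      ‖(timeDeriv φ z.1 z.2 + ν * (Δ (φ z.1)) z.2) * ⟪u z.1 z.2, c⟫ * η z.1 z.2
        + ∑ i, (2 * ν * fderiv ℝ (φ z.1) z.2 (b i)) * ⟪u z.1 z.2, c⟫ * fderiv ℝ (η z.1) z.2 (b i)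
        + ∑ i, fderiv ℝ (φ z.1) z.2 (b i) * (⟪u z.1 z.2, b i⟫ * ⟪u z.1 z.2, c⟫) * η z.1 z.2
        + ∑ i, φ z.1 z.2 * (⟪u z.1 z.2, b i⟫ * ⟪u z.1 z.2, c⟫) * fderiv ℝ (η z.1) z.2 (b i)
        + fderiv ℝ (φ z.1) z.2 c * p z.1 z.2 * η z.1 z.2
        + φ z.1 z.2 * ⟪f z.1 z.2, c⟫ * η z.1 z.2‖ₑ +
      ‖φ z.1 z.2 * p z.1 z.2 * L z.1 z.2
        + (-(Δ (φ z.1)) z.2) * p z.1 z.2 * Ξ z.1 z.2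
        + ∑ i, (-(2 * fderiv ℝ (φ z.1) z.2 (b i))) * p z.1 z.2 * fderiv ℝ (Ξ z.1) z.2 (b i)
        + ∑ i, ∑ j, (-(φ z.1 z.2)) * (⟪u z.1 z.2, b i⟫ * ⟪u z.1 z.2, b j⟫) *
            fderiv ℝ (fun y => fderiv ℝ (Ξ z.1) y (b i)) z.2 (b j)
        + ∑ i, ∑ j, (-(fderiv ℝ (fun y => fderiv ℝ (φ z.1) y (b i)) z.2 (b j))) *
            (⟪u z.1 z.2, b i⟫ * ⟪u z.1 z.2, b j⟫) * Ξ z.1 z.2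
        + ∑ i, ∑ j, (-(2 * fderiv ℝ (φ z.1) z.2 (b j))) * (⟪u z.1 z.2, b j⟫ * ⟪u z.1 z.2, b i⟫) *
            fderiv ℝ (Ξ z.1) z.2 (b i)‖ₑ ≤
      Γ * (Sθ * D z) + ENNReal.ofReal (3 * Cη4 + 9 * CΞ4) * (U2 z * K₄ z) +
        ENNReal.ofReal Cη3 * (Ff z * K₃ z) := by
    intro z
    refine (add_le_add (hAV z) (hBV z)).trans (le_of_eq ?_)
    have h3 : ENNReal.ofReal (3 * Cη4 + 9 * CΞ4) = 3 * ENNReal.ofReal Cη4 + 9 * ENNReal.ofReal CΞ4 := by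
      rw [ENNReal.ofReal_add (by positivity) (by positivity), ENNReal.ofReal_mul (by norm_num),
        ENNReal.ofReal_mul (by norm_num), ENNReal.ofReal_ofNat, ENNReal.ofReal_ofNat]
    rw [hΓ_def, h3]
    ring
  /- ### integrate -/
  have mUK : AEMeasurable (fun z => U2 z * K₄ z) volume := hU2m.mul hK₄m.aemeasurable
  have mFK : AEMeasurable (fun z => Ff z * K₃ z) volume := hFfm.mul hK₃m.aemeasurable
  have mSD : AEMeasurable (fun z => Sθ * D z) volume := hDm.const_mul _
  have m2 : AEMeasurable (fun z => ENNReal.ofReal (3 * Cη4 + 9 * CΞ4) * (U2 z * K₄ z)) volume :=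
    mUK.const_mul _
  have m3 : AEMeasurable (fun z => ENNReal.ofReal Cη3 * (Ff z * K₃ z)) volume := mFK.const_mul _
  have hI : ∫⁻ z, (Γ * (Sθ * D z) + ENNReal.ofReal (3 * Cη4 + 9 * CΞ4) * (U2 z * K₄ z) +
        ENNReal.ofReal Cη3 * (Ff z * K₃ z)) =
      Γ * Sθ * (∫⁻ z, D z) + (ENNReal.ofReal (3 * Cη4 + 9 * CΞ4) * (∫⁻ z, U2 z * K₄ z) +
        ENNReal.ofReal Cη3 * (∫⁻ z, Ff z * K₃ z)) := by
    rw [lintegral_add_right' _ m3, lintegral_add_right' _ m2, lintegral_const_mul'' _ mSD,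
      lintegral_const_mul'' _ hDm, lintegral_const_mul'' _ mUK, lintegral_const_mul'' _ mFK]
    ring
  /- ### Tonelli: the two main terms are potentials of the data -/
  have hUfin : ∀ z, U2 z ≠ ∞ := fun z => by
    by_cases hz : z ∈ K
    · rw [show U2 z = ‖u z.1 z.2‖ₑ * ‖u z.1 z.2‖ₑ from indicator_of_mem hz _]
      exact ENNReal.mul_ne_top enorm_ne_top enorm_ne_top
    · rw [show U2 z = 0 from indicator_of_notMem hz _]; exact ENNReal.zero_ne_top
  have hFfin : ∀ z, Ff z ≠ ∞ := fun z => by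
    by_cases hz : z ∈ K
    · rw [show Ff z = ‖f z.1 z.2‖ₑ from indicator_of_mem hz _]; exact enorm_ne_top
    · rw [show Ff z = 0 from indicator_of_notMem hz _]; exact ENNReal.zero_ne_top
  have hT4 : ∫⁻ z, U2 z * K₄ z ≤ ∫⁻ w : ℝ × EuclideanSpace ℝ (Fin 3), parabolicRieszPotential 1
      (Q₂.indicator fun w => ‖u w.1 w.2‖ₑ * ‖u w.1 w.2‖ₑ) w * ‖θ w.1 w.2‖ₑ := by
    rw [show (fun z => U2 z * K₄ z) = fun z => U2 z * ∫⁻ w, k₄ (z, w) * ‖θ w.1 w.2‖ₑ from rfl,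
      lintegral_mul_lintegral_swap hU2m hUfin hk₄m hθm (fun w => enorm_ne_top)]
    refine lintegral_mono fun w => mul_le_mul' ?_ le_rfl
    show ∫⁻ z, U2 z * k₄ (z, w) ≤ ∫⁻ z, (Q₂.indicator fun w => ‖u w.1 w.2‖ₑ * ‖u w.1 w.2‖ₑ) z *
      (ENNReal.ofReal (parabolicDist w z) ^ ((5 : ℝ) - 1))⁻¹
    refine lintegral_mono fun z => ?_
    have hk : k₄ (z, w) = (ENNReal.ofReal (parabolicDist w z) ^ ((5 : ℝ) - 1))⁻¹ := by
      simp only [hk₄_def, parabolicDist_comm z w]; norm_num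
    rw [hk]
    exact mul_le_mul' (indicator_le_indicator_of_subset hKQ₂ (fun _ => zero_le) z) le_rfl
  have hT3 : ∫⁻ z, Ff z * K₃ z ≤ ∫⁻ w : ℝ × EuclideanSpace ℝ (Fin 3), parabolicRieszPotential 2
      (Q₂.indicator fun w => ‖f w.1 w.2‖ₑ) w * ‖θ w.1 w.2‖ₑ := by
    rw [show (fun z => Ff z * K₃ z) = fun z => Ff z * ∫⁻ w, k₃ (z, w) * ‖θ w.1 w.2‖ₑ from rfl,
      lintegral_mul_lintegral_swap hFfm hFfin hk₃m hθm (fun w => enorm_ne_top)]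
    refine lintegral_mono fun w => mul_le_mul' ?_ le_rfl
    show ∫⁻ z, Ff z * k₃ (z, w) ≤ ∫⁻ z, (Q₂.indicator fun w => ‖f w.1 w.2‖ₑ) z *
      (ENNReal.ofReal (parabolicDist w z) ^ ((5 : ℝ) - 2))⁻¹
    refine lintegral_mono fun z => ?_
    have hk : k₃ (z, w) = (ENNReal.ofReal (parabolicDist w z) ^ ((5 : ℝ) - 2))⁻¹ := by
      simp only [hk₃_def, parabolicDist_comm z w]; norm_num
    rw [hk]
    exact mul_le_mul' (indicator_le_indicator_of_subset hKQ₂ (fun _ => zero_le) z) le_rfl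
  /- ### conclusion -/
  refine (enorm_add_le _ _).trans ?_
  refine (add_le_add (enorm_integral_le_lintegral_enorm _) (enorm_integral_le_lintegral_enorm _)).trans ?_
  refine (add_le_add (setLIntegral_le_lintegral _ _) (setLIntegral_le_lintegral _ _)).trans ?_
  refine (le_lintegral_add _ _).trans ?_
  refine (lintegral_mono fun z => hpt z).trans ?_
  rw [hI]
  refine add_le_add (le_of_eq (by ring)) ?_
  set X₁ : ℝ≥0∞ := ∫⁻ w : ℝ × EuclideanSpace ℝ (Fin 3), parabolicRieszPotential 1
      (Q₂.indicator fun w => ‖u w.1 w.2‖ₑ * ‖u w.1 w.2‖ₑ) w * ‖θ w.1 w.2‖ₑ with hX₁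
  set X₂ : ℝ≥0∞ := ∫⁻ w : ℝ × EuclideanSpace ℝ (Fin 3), parabolicRieszPotential 2
      (Q₂.indicator fun w => ‖f w.1 w.2‖ₑ) w * ‖θ w.1 w.2‖ₑ with hX₂
  have hsplit : X₂ + X₁ ≤ ∫⁻ w : ℝ × EuclideanSpace ℝ (Fin 3), (parabolicRieszPotential 2
      (Q₂.indicator fun w => ‖f w.1 w.2‖ₑ) w + parabolicRieszPotential 1
      (Q₂.indicator fun w => ‖u w.1 w.2‖ₑ * ‖u w.1 w.2‖ₑ) w) * ‖θ w.1 w.2‖ₑ := by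
    refine (le_lintegral_add _ _).trans (le_of_eq (lintegral_congr fun w => ?_))
    rw [add_mul]
  have hc₂ : ENNReal.ofReal (3 * Cη4 + 9 * CΞ4) ≤ ENNReal.ofReal (3 * Cη4 + 9 * CΞ4 + Cη3) :=
    ENNReal.ofReal_le_ofReal (by linarith)
  have hc₃ : ENNReal.ofReal Cη3 ≤ ENNReal.ofReal (3 * Cη4 + 9 * CΞ4 + Cη3) :=
    ENNReal.ofReal_le_ofReal (by nlinarith)
  calc ENNReal.ofReal (3 * Cη4 + 9 * CΞ4) * (∫⁻ z, U2 z * K₄ z) + ENNReal.ofReal Cη3 * ∫⁻ z, Ff z * K₃ z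
      ≤ ENNReal.ofReal (3 * Cη4 + 9 * CΞ4 + Cη3) * X₁ + ENNReal.ofReal (3 * Cη4 + 9 * CΞ4 + Cη3) * X₂ :=
        add_le_add (mul_le_mul' hc₂ hT4) (mul_le_mul' hc₃ hT3)
    _ = ENNReal.ofReal (3 * Cη4 + 9 * CΞ4 + Cη3) * (X₂ + X₁) := by ring
    _ ≤ _ := mul_le_mul' le_rfl hsplit


end Estimate

end Literature.Analysis.FluidPDE
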